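import Summits.QuantumFields.YangMills.Theorems.UnitScaleTiltHalvingStepOfPillarsCEPrime
import Summits.QuantumFields.YangMills.Theorems.UnitScaleTiltProp8HalvingDressedCriticalitySU2
import Summits.QuantumFields.YangMills.Theorems.UnitScaleTiltProp8HalvingHcritTransfer
import HarnessLib

/-!
# Route `UnitScaleTilt`, crux K1 «MinimiserStabilityRegPr» (stmt-QuantumFields-19200), stub V2′ `stub_halvingStep` — (K-E2E) door, C_E end, lemma L2:
# **HYPOTHESIS (i) OF THE (165)-A₁ ROW FROM THE ROUTE'S MINIMALITY** — ✓`tracePairing_of_isMinOn_dressed_wilson_su2` with `hΨsa`∕`hU`∕`hS₀`∕`hD`∕`hAQ` DISCHARGED by name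
# (✓`dressed_competitor_su2`, ✓`exists_lineRadius_of_mem_weightedBall`, FILE E's (49)∕(55)∕uniqueness∕differentiability shapes) and `hmin` by ✓`hmin_of_hcrit`; displayed: (Φ-1), (Φ-2).

Cell `ym3-torus` (HUMAN RULING D-0037: rung R3, not Clay), width seat `ym-ust-19200-w8` g0∕s2.  `--supports stmt-QuantumFields-19200 --as helper`; def-free, 0 sorry.
NOT a claim about the stub, the crux, the rung or the gap.  References: T. Bałaban, CMP **102** (1985) [Balaban1985Variational] (47)-(49) p.285, (99) p.293, (150) p.301, (157)-(158) p.302.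
-/

set_option autoImplicit false

noncomputable section

open scoped BigOperators Matrix Matrix.Norms.L2Operator
open NormedSpace

namespace Summit.QuantumFields.YangMills.Theorems.HalvingSitePackage

open Literature.MathematicalPhysics.QuantumFieldTheory.Balaban1983to89
open Literature.MathematicalPhysics.QuantumFieldTheory.Balaban1983to89.T3ContinuumYM3Torus
open Literature.MathematicalPhysics.QuantumFieldTheory.Balaban1983to89.T3PrintedRegularMinimiser
open B6SectADomainsV1 (Domains)
open B6SectAOperatorsV1 (BondIdx QE)
open LatticeFieldCalculus (bondAvgIter)
open FlatCubeOpsText (IsLevWeight)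
open FlatOpsLettersAssembly (flatH levWeight_nonneg)
open Prop8ChartDoubleBar (chartLogFlat dressed_competitor_su2 exists_lineRadius_of_mem_weightedBall)

variable {F : T3Family} {n K : ℕ}

/-- **L2: (i) OF THE (165) ROW FROM `hcrit`** — see the module docstring; `A` is the chart preimage (L1's `A′`), `H` the level-scaled extension `Hs`, `D` the dressing map `Dsel` of FILE E,
`Uc` an `SU(2)` chart of 𝔰𝔲(2)-valued fields (✓`exists_su2Chart`). [cite: Balaban1985Variational, (47)-(49) p.285, (99) p.293, (157)-(158) p.302] -/
theorem hpair_of_hcrit (F : T3Family) (n K : ℕ) (Dm : Domains (F.P K)) (hDk : Dm.k = K - n)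
    (hcollar : ∀ (i : ℕ) (e : PBond (F.P K) (i + 1)), Dm.LamBond (i + 1) e → ∀ z : Site (F.P K) i, (blockOf z = e.src ∨ blockOf z = e.tgt) → z ∈ Dm.Om i)
    {w : ℕ → PBond (F.P K) 0 → ℝ} (hw : IsLevWeight F n K Dm w)
    {R : ℝ} (hR : 16 * 3800 * ((((F.P K).d + 2) * (F.P K).L : ℕ) : ℝ) ^ 2 * (F.L : ℝ) * R ≤ 1)
    (η : ℝ) (hη : η ≠ 0)
    (W₀ : (PBond (F.P K) 0 → Matrix (Fin 2) (Fin 2) ℂ) → (PBond (F.P K) 0 → Matrix (Fin 2) (Fin 2) ℂ)) (hSd : Differentiable ℂ (fun A : PBond (F.P K) 0 → Matrix (Fin 2) (Fin 2) ℂ => (∑ p : Plaq (F.P K) 0, (1 - (2 : ℂ)⁻¹ * Matrix.trace (exp ((Complex.I * (η : ℂ)) • A ⟨p.src, p.μ⟩) * exp ((Complex.I * (η : ℂ)) • A ⟨p.src.shift p.μ, p.ν⟩) * exp (-((Complex.I * (η : ℂ)) • A ⟨p.src.shift p.ν, p.μ⟩)) * exp (-((Complex.I * (η : ℂ)) • A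 ⟨p.src, p.ν⟩)))))))
    (hgrad : ∀ A δ : PBond (F.P K) 0 → Matrix (Fin 2) (Fin 2) ℂ, fderiv ℂ (fun A : PBond (F.P K) 0 → Matrix (Fin 2) (Fin 2) ℂ => (∑ p : Plaq (F.P K) 0, (1 - (2 : ℂ)⁻¹ * Matrix.trace (exp ((Complex.I * (η : ℂ)) • A ⟨p.src, p.μ⟩) * exp ((Complex.I * (η : ℂ)) • A ⟨p.src.shift p.μ, p.ν⟩) * exp (-((Complex.I * (η : ℂ)) • A ⟨p.src.shift p.ν, p.μ⟩)) * exp (-((Complex.I * (η : ℂ)) • A ⟨p.src, p.ν⟩)))))) A δ =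
      ((η : ℂ) ^ 2 / 2) * ∑ p : Plaq (F.P K) 0, Matrix.trace ((A ⟨p.src, p.μ⟩ + A ⟨p.src.shift p.μ, p.ν⟩ - A ⟨p.src.shift p.ν, p.μ⟩ - A ⟨p.src, p.ν⟩) * (δ ⟨p.src, p.μ⟩ + δ ⟨p.src.shift p.μ, p.ν⟩ - δ ⟨p.src.shift p.ν, p.μ⟩ - δ ⟨p.src, p.ν⟩)) + (η : ℂ) ^ 4 * ∑ b : PBond (F.P K) 0, Matrix.trace (W₀ A b * δ b))
    (H : (BondIdx Dm → Matrix (Fin 2) (Fin 2) ℂ) →ₗ[ℂ] (PBond (F.P K) 0 → Matrix (Fin 2) (Fin 2) ℂ))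
    (hHs : ∀ X b, H X b = ∑ c, (flatH F n K Dm (Pi.single c 1) b * ((F.L : ℝ) ^ (c.1.1 : ℕ) * ((F.L : ℝ)⁻¹) ^ (K - n))⁻¹) • X c)
    (D : (PBond (F.P K) 0 → Matrix (Fin 2) (Fin 2) ℂ) → (BondIdx Dm → Matrix (Fin 2) (Fin 2) ℂ))
    (E : (PBond (F.P K) 0 → Matrix (Fin 2) (Fin 2) ℂ) → (PBond (F.P K) 0 → Matrix (Fin 2) (Fin 2) ℂ))
    (hE : ∀ (Y : PBond (F.P K) 0 → Matrix (Fin 2) (Fin 2) ℂ) (b : PBond (F.P K) 0) (i j : Fin 2), E Y b i j = ((η : ℂ) ^ 4)⁻¹ *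
      (-(((η : ℂ) ^ 2 / 2) * ∑ p : Plaq (F.P K) 0, Matrix.trace ((H (D Y) ⟨p.src, p.μ⟩ + H (D Y) ⟨p.src.shift p.μ, p.ν⟩ - H (D Y) ⟨p.src.shift p.ν, p.μ⟩ - H (D Y) ⟨p.src, p.ν⟩) *
          ((Pi.single b (Matrix.single j i (1 : ℂ)) : PBond (F.P K) 0 → Matrix (Fin 2) (Fin 2) ℂ) ⟨p.src, p.μ⟩ + (Pi.single b (Matrix.single j i (1 : ℂ)) : PBond (F.P K) 0 → Matrix (Fin 2) (Fin 2) ℂ) ⟨p.src.shift p.μ, p.ν⟩ -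
            (Pi.single b (Matrix.single j i (1 : ℂ)) : PBond (F.P K) 0 → Matrix (Fin 2) (Fin 2) ℂ) ⟨p.src.shift p.ν, p.μ⟩ - (Pi.single b (Matrix.single j i (1 : ℂ)) : PBond (F.P K) 0 → Matrix (Fin 2) (Fin 2) ℂ) ⟨p.src, p.ν⟩)))
        - ((η : ℂ) ^ 2 / 2) * ∑ p : Plaq (F.P K) 0, Matrix.trace (((Y - H (D Y)) ⟨p.src, p.μ⟩ + (Y - H (D Y)) ⟨p.src.shift p.μ, p.ν⟩ - (Y - H (D Y)) ⟨p.src.shift p.ν, p.μ⟩ - (Y - H (D Y)) ⟨p.src, p.ν⟩) *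
          (H (fderiv ℂ D Y (Pi.single b (Matrix.single j i (1 : ℂ)))) ⟨p.src, p.μ⟩ + H (fderiv ℂ D Y (Pi.single b (Matrix.single j i (1 : ℂ)))) ⟨p.src.shift p.μ, p.ν⟩ -
            H (fderiv ℂ D Y (Pi.single b (Matrix.single j i (1 : ℂ)))) ⟨p.src.shift p.ν, p.μ⟩ - H (fderiv ℂ D Y (Pi.single b (Matrix.single j i (1 : ℂ)))) ⟨p.src, p.ν⟩))
        - (η : ℂ) ^ 4 * ∑ b' : PBond (F.P K) 0, Matrix.trace (W₀ (Y - H (D Y)) b' * H (fderiv ℂ D Y (Pi.single b (Matrix.single j i (1 : ℂ)))) b')))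
    {r₁ t : ℝ}
    (h49 : ∀ X : PBond (F.P K) 0 → Matrix (Fin 2) (Fin 2) ℂ, (∀ b, w 1 b * ‖X b‖ < r₁) → (fun (Z : PBond (F.P K) 0 → Matrix (Fin 2) (Fin 2) ℂ) => chartLogFlat ((((F.L : ℝ))⁻¹) ^ (K - n)) Dm Z - (fderiv ℂ (chartLogFlat ((((F.L : ℝ))⁻¹) ^ (K - n)) Dm : (PBond (F.P K) 0 → Matrix (Fin 2) (Fin 2) ℂ) → BondIdx Dm → Matrix (Fin 2) (Fin 2) ℂ) 0) Z) (X - H (D X)) = D X)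
    (hsize : ∀ X : PBond (F.P K) 0 → Matrix (Fin 2) (Fin 2) ℂ, (∀ b, w 1 b * ‖X b‖ < r₁) → ∀ c, ‖D X c‖ ≤ t)
    (huniq : ∀ X : PBond (F.P K) 0 → Matrix (Fin 2) (Fin 2) ℂ, (∀ b, w 1 b * ‖X b‖ < r₁) → ∀ D' : BondIdx Dm → Matrix (Fin 2) (Fin 2) ℂ, (∀ c, ‖D' c‖ ≤ t) → (fun (Z : PBond (F.P K) 0 → Matrix (Fin 2) (Fin 2) ℂ) => chartLogFlat ((((F.L : ℝ))⁻¹) ^ (K - n)) Dm Z - (fderiv ℂ (chartLogFlat ((((F.L : ℝ))⁻¹) ^ (K - n)) Dm : (PBond (F.P K) 0 → Matrix (Fin 2) (Fin 2) ℂ) → BondIdx Dm → Matrix (Fin 2) (Fin 2) ℂ) 0) Z) (X - H D') = D' → D' = D X)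
    (hDd : ∀ X : PBond (F.P K) 0 → Matrix (Fin 2) (Fin 2) ℂ, (∀ b, w 1 b * ‖X b‖ < r₁) → DifferentiableAt ℂ D X)
    (hball : ∀ X : PBond (F.P K) 0 → Matrix (Fin 2) (Fin 2) ℂ, (∀ b, w 1 b * ‖X b‖ < r₁) → ∀ b, w 1 b * ‖(X - H (D X)) b‖ < R)
    (Uc : (PBond (F.P K) 0 → Matrix (Fin 2) (Fin 2) ℂ) → GaugeField (F.P K) 0 (Matrix.specialUnitaryGroup (Fin 2) ℂ))
    (hUc : ∀ Y : PBond (F.P K) 0 → Matrix (Fin 2) (Fin 2) ℂ, (∀ b, IsSelfAdjoint (Y b)) → (∀ b, Matrix.trace (Y b) = 0) →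
      ∀ b, ((Uc Y b : Matrix.specialUnitaryGroup (Fin 2) ℂ) : Matrix (Fin 2) (Fin 2) ℂ) = exp ((Complex.I * (η : ℂ)) • Y b))
    {A : PBond (F.P K) 0 → Matrix (Fin 2) (Fin 2) ℂ} (hAsa : ∀ b, IsSelfAdjoint (A b)) (hAtr : ∀ b, Matrix.trace (A b) = 0) (hAS : ∀ b, w 1 b * ‖A b‖ < r₁)
    (hnK : n ≤ K) (ε₀ : ℝ) (V : GaugeField (F.P n) 0 (Matrix.specialUnitaryGroup (Fin 2) ℂ)) {Umin : GaugeField (F.P K) 0 (Matrix.specialUnitaryGroup (Fin 2) ℂ)}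
    (hcrit : IsMinOn (fun W : GaugeField (F.P K) 0 (Matrix.specialUnitaryGroup (Fin 2) ℂ) => wilsonAction4 W) (regFibrePr F n K hnK ε₀ V) Umin)
    (hΦ1 : ∀ X ∈ {X : PBond (F.P K) 0 → Matrix (Fin 2) (Fin 2) ℂ | (∀ b, IsSelfAdjoint (X b)) ∧ (∀ b, Matrix.trace (X b) = 0) ∧ (∀ c : BondIdx Dm, bondAvgIter (c.1.1 : ℕ) X c.1.2 = bondAvgIter (c.1.1 : ℕ) A c.1.2) ∧ X ∈ {Y : PBond (F.P K) 0 → Matrix (Fin 2) (Fin 2) ℂ | ∀ b, w 1 b * ‖Y b‖ < r₁}}, Uc (X - H (D X)) ∈ regFibrePr F n K hnK ε₀ V)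
    (uS : GaugeTransf (F.P K) 0 (Matrix.specialUnitaryGroup (Fin 2) ℂ)) (hΦ2 : Uc (A - H (D A)) = GaugeField.gaugeAct uS Umin) :
    ∀ s : PBond (F.P K) 0 → ℝ, QE Dm (WithLp.toLp 2 s) = 0 → ∀ Et : Matrix (Fin 2) (Fin 2) ℂ, IsSelfAdjoint Et → Matrix.trace Et = 0 →
    (((η : ℂ) ^ 2 / 2) * ∑ p : Plaq (F.P K) 0, Matrix.trace ((A ⟨p.src, p.μ⟩ + A ⟨p.src.shift p.μ, p.ν⟩ - A ⟨p.src.shift p.ν, p.μ⟩ - A ⟨p.src, p.ν⟩) * (((s ⟨p.src, p.μ⟩ : ℝ) : ℂ) • Et + ((s ⟨p.src.shift p.μ, p.ν⟩ : ℝ) : ℂ) • Et - ((s ⟨p.src.shift p.ν, p.μ⟩ : ℝ) : ℂ) • Et - ((s ⟨p.src, p.ν⟩ : ℝ) : ℂ) • Et)) +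
      (η : ℂ) ^ 4 * ∑ b : PBond (F.P K) 0, Matrix.trace ((W₀ (A - H (D A)) b + E A b) * (((s b : ℝ) : ℂ) • Et))).re = 0 := by
  have hw1 : ∀ b, 0 ≤ w 1 b := fun b => levWeight_nonneg hw 1 b
  set k : PBond (F.P K) 0 → BondIdx Dm → ℝ := fun b c => flatH F n K Dm (Pi.single c 1) b * ((F.L : ℝ) ^ (c.1.1 : ℕ) * ((F.L : ℝ)⁻¹) ^ (K - n))⁻¹ with hk
  have hHs' : ∀ X b, H X b = ∑ c, k b c • X c := hHs
  -- the dressed competitors are 𝔰𝔲(2)-valued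
  have hdress : ∀ X : PBond (F.P K) 0 → Matrix (Fin 2) (Fin 2) ℂ, (∀ b, IsSelfAdjoint (X b)) → (∀ b, Matrix.trace (X b) = 0) → (∀ b, w 1 b * ‖X b‖ < r₁) →
      (∀ b, IsSelfAdjoint ((X - H (D X)) b)) ∧ ∀ b, Matrix.trace ((X - H (D X)) b) = 0 := fun X hXsa hXtr hXS =>
    dressed_competitor_su2 F n K Dm hDk hcollar hw hR H k hHs' hXsa hXtr (hball X hXS) (h49 X hXS) (hsize X hXS) (huniq X hXS)
  refine HalvingDressedCriticalitySU2.tracePairing_of_isMinOn_dressed_wilson_su2 Dm η hη W₀ hSd hgrad H D E hE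
    (S₀ := {Y : PBond (F.P K) 0 → Matrix (Fin 2) (Fin 2) ℂ | ∀ b, w 1 b * ‖Y b‖ < r₁}) (Bdat := fun c => bondAvgIter (c.1.1 : ℕ) A c.1.2)
    (fun X => Uc (X - H (D X))) (fun X hX => (hdress X hX.1 hX.2.1 hX.2.2.2).1) (fun X hX => hUc _ (hdress X hX.1 hX.2.1 hX.2.2.2).1 (hdress X hX.1 hX.2.1 hX.2.2.2).2)
    hAsa hAtr (fun c => rfl) hAS (fun δ => ?_) (hDd A hAS) ?_
  · obtain ⟨r, hr, h⟩ := exists_lineRadius_of_mem_weightedBall (w 1) hw1 hAS δ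
    exact ⟨r, hr, fun t ht => h t ht⟩
  · exact HalvingHcritTransfer.hmin_of_hcrit hnK ε₀ V hcrit _ (fun X => Uc (X - H (D X))) hΦ1 uS hΦ2

end Summit.QuantumFields.YangMills.Theorems.HalvingSitePackage

end
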